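/-
Copyright (c) 2026 the pub-hodgecm-mathlib formalisation cell (harness21).  Prover seat hodgecm-mathlib-F0P2-p06 (g13): road «S3-ram» (LEAD F0P3a-plan (g12); architect
A-p16 (g31); junction pen F0P3a-p01 (g17), J-PACK v2 ROW-O; owner F0P3a-p06 (g15)); 2026-09-02.
-/
import Literature.NumberTheory.Automorphic.UnitaryLatticeTreeFixedChildPivotRamified   -- ★ p847433 (F0P2-p01): FILE J pivot ∕ kernel; brings ★ FILES H (tokens), F (class), E (depth)
import HarnessLib

/-!
# The lattice graph of a hermitian space — THE LABELS OF THE GRANDCHILDREN OF AN ODD-DEPTH FIXED VERTEX, PER LINE, at a tamely ramified place (J-PACK v2 ROW-O, label side):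
# NULL line off the kernel ⇒ `(d−1, rank 2)`; NON-NULL line of class `s` ⇒ `(d−2, rank ≤ 1)` with class EXACTLY `−s` (Bruhat–Tits 1972 §10; Tits 1979 §3.5; Kottwitz 1986 §3)

Topic `NumberTheory/Automorphic`; namespace `Literature.NumberTheory.Automorphic.UnitaryLatticeTree`.  THEOREMS ONLY (no definition, no instance, no notation, no named fact,
no `sorry`); kernel lane `--supports stmt-HodgeConjecture-24833`.  Cell `pub/hodgecm-mathlib` (D-0151), crux H413; road «S3-ram» (Literature seeding, count-neutral);
J-PACK v2 (junction pen F0P3a-p01 (g17)) ROW-O «ODD REGULAR VERTEX», LABEL SIDE, in the frame of ★ FILE L `UnitaryLatticeTreeFixedGrandchildFrameRamified` (F0P2-p01):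
a grandchild `Λ′ = latt(κ′·g(a,b))` (`κ′` unitary with `latt κ′ = v`, `g(a,b) = !![a∕ϖ,0,0; 0,1,0; b,0,ϖ]`, `|a| = 1`, `|b| ≤ 1`) of a fixed self-dual vertex `v` of depth `d`
(`(γ−1)·v ⊆ ϖ^d·v`), read on the conjugate `M′ = κ′⁻¹(γ−1)κ′` whose CORNER `M′₂₀ = B₀(κ′e₀, (γ−1)κ′e₀)` is the value of the residual form on the line of the modular neighbour
`κ′·N₁`.  This file only PACKAGES ★ FILES E∕F∕H∕J (F0P2-p01) into the two per-line label statements of ROW-O and adds the converse class statement (exclusion):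
* §1 **`childLabels_of_null_of_not_col`** — corner null (`|M′₂₀| ≤ |ϖ|^{d+1}`) and the line OFF the kernel (`¬ ∀ i, |M′_{i0}| ≤ |ϖ|^{d+1}`), residual nilpotency
  `(γ−1)³·v ⊆ ϖ^{3d+1}·v` ⇒ `LEV(ϖ^{d−1}) Λ′ ∧ ¬LEV(ϖ^d) Λ′ ∧ ¬LEV₂(ϖ^{2d−1}) Λ′` (★ H `…_pred_iff` + ★ J `not_lev_and_not_lev₂_childLatt_of_cube_le`);
* §2 **`childLabels_of_not_null`** — corner a unit ⇒ `LEV(ϖ^{d−2}) Λ′ ∧ ¬LEV(ϖ^{d−1}) Λ′ ∧ LEV₂(ϖ^{2d−3}) Λ′` (★ H `…_pred_pred`, `…_pred_iff`, `…_sq_…_of_le`);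
* §3 **`childClass_iff_lineClass_neg`** — for a unit `c′`: `CLS[Λ′] (d−2) c′ ↔` the line has class `−c′` (`∃ a₀, |a₀| = 1 ∧ |(ϖ^d)⁻¹M′₂₀ + c′a₀²| < 1`); «⇐» is ★ H
  `exists_mem_childLatt_class_neg_of_lineClass`, «⇒» is EXCLUSION by ★ F `v_B₀_mulVec_add_sq_mul_lt` (on the dual box the form IS `−M′₂₀·u₀²` to order `d−2`, so a class
  met at ANY `y ∈ Λ′` is the class of `−M′₂₀`).
`CLS[Λ′] d c := ∃ y ∈ Λ′, ∃ a, |a| = 1 ∧ |(ϖ^d)⁻¹·pairing(y, (γ−1)y) − c·a²| < 1` (J-PACK v2 §1 VERBATIM).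

HONEST LABEL: HC_CM is proved only modulo the 2 remaining named inputs (hLiu418 24832, h413 24833) until rung 0 closes; nothing printed is asserted here (elementary lattice
algebra over ★ results); «S3-ram» has no books consequence.

## References
* [BruhatTits1972] F. Bruhat, J. Tits, *Groupes réductifs sur un corps local I*, Publ. Math. IHÉS 41 (1972), §10 (vertex stabilisers and their congruence filtration).
* [Tits1979] J. Tits, *Reductive groups over local fields*, PSPM 33.1 (1979), §3.5 (reduction mod `𝔭`).
* [Kottwitz1986] R. E. Kottwitz, *Base change for unit elements of Hecke algebras*, Compositio Math. 60 (1986), §3 (the level∕class of a fixed lattice; shell recursion).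
* [Serre1980Trees] J.-P. Serre, *Trees* (1980), Ch. II §1.1 (lattices and frames).
-/

set_option autoImplicit false

noncomputable section

open scoped Valued WithZero Matrix MatrixGroups

namespace Literature.NumberTheory.Automorphic.UnitaryLatticeTree

open Literature.NumberTheory.Automorphic Literature.NumberTheory.Automorphic.HermitianLattice

variable {K : Type*} [Field K] [Valued K ℤᵐ⁰] {σ : K →+* K} {ϖ : K}

/-! ## §1 A NULL line off the kernel: the grandchild is `(d−1, rank 2)` -/

/-- **NULL LINE OFF THE KERNEL ⇒ `(d−1, rank 2)`.**  At the grandchild `Λ′ = latt(κ′·g(a,b))` of the depth-`d` fixed vertex `latt κ′` (`d ≥ 1`, residual nilpotency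
`(γ−1)³·v ⊆ ϖ^{3d+1}·v`): if the corner passes (`|M′₂₀| ≤ |ϖ|^{d+1}`, the line is `Q_Ȳ`-null) but the first column does not (`x̄ ∉ ker Ȳ`), then `(γ−1)·Λ′ ⊆ ϖ^{d−1}Λ′`,
`¬ (γ−1)·Λ′ ⊆ ϖ^d Λ′`, `¬ (γ−1)²·Λ′ ⊆ ϖ^{2d−1}Λ′` (★ FILE H `map_sub_one_childLatt_le_scaleLattice_pred_iff`, ★ FILE J `not_lev_and_not_lev₂_childLatt_of_cube_le`).
[cite: Kottwitz1986, §3] [cite: Tits1979, §3.5] [cite: BruhatTits1972, §10] -/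
theorem childLabels_of_null_of_not_col (hvσ : ∀ z, Valued.v (σ z) = Valued.v z) (hϖ : Valued.v ϖ = WithZero.exp (-1 : ℤ))
    (κ γ : unitaryGroupOfForm σ ((StdForm.antidiagonal 3).over K)) {a b : K} (ha : Valued.v a = 1) (hb : Valued.v b ≤ 1) {d : ℕ} (hd : 1 ≤ d)
    (hM : ∀ i j, Valued.v (((((κ : GL (Fin 3) K)⁻¹ : GL (Fin 3) K) : Matrix (Fin 3) (Fin 3) K) * (((γ : GL (Fin 3) K) : Matrix (Fin 3) (Fin 3) K) - 1) *
      ((κ : GL (Fin 3) K) : Matrix (Fin 3) (Fin 3) K)) i j) ≤ Valued.v ϖ ^ d)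
    (hlev : (latt ((κ : GL (Fin 3) K) : Matrix (Fin 3) (Fin 3) K)).map ((Matrix.toLin' (((γ : GL (Fin 3) K) : Matrix (Fin 3) (Fin 3) K) - 1)).restrictScalars 𝒪[K]) ≤
      scaleLattice (ϖ ^ d) (latt ((κ : GL (Fin 3) K) : Matrix (Fin 3) (Fin 3) K)))
    (hnil : (latt ((κ : GL (Fin 3) K) : Matrix (Fin 3) (Fin 3) K)).map ((Matrix.toLin' ((((γ : GL (Fin 3) K) : Matrix (Fin 3) (Fin 3) K) - 1) ^ 3)).restrictScalars 𝒪[K]) ≤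
      scaleLattice (ϖ ^ (3 * d + 1)) (latt ((κ : GL (Fin 3) K) : Matrix (Fin 3) (Fin 3) K)))
    (h20 : Valued.v (((((κ : GL (Fin 3) K)⁻¹ : GL (Fin 3) K) : Matrix (Fin 3) (Fin 3) K) * (((γ : GL (Fin 3) K) : Matrix (Fin 3) (Fin 3) K) - 1) *
      ((κ : GL (Fin 3) K) : Matrix (Fin 3) (Fin 3) K)) 2 0) ≤ Valued.v ϖ ^ (d + 1))
    (hcol : ¬ ∀ i, Valued.v (((((κ : GL (Fin 3) K)⁻¹ : GL (Fin 3) K) : Matrix (Fin 3) (Fin 3) K) * (((γ : GL (Fin 3) K) : Matrix (Fin 3) (Fin 3) K) - 1) *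
      ((κ : GL (Fin 3) K) : Matrix (Fin 3) (Fin 3) K)) i 0) ≤ Valued.v ϖ ^ (d + 1)) :
    (latt (((κ : GL (Fin 3) K) : Matrix (Fin 3) (Fin 3) K) * !![a / ϖ, 0, 0; 0, 1, 0; b, 0, ϖ])).map
          ((Matrix.toLin' (((γ : GL (Fin 3) K) : Matrix (Fin 3) (Fin 3) K) - 1)).restrictScalars 𝒪[K]) ≤
        scaleLattice (ϖ ^ (d - 1)) (latt (((κ : GL (Fin 3) K) : Matrix (Fin 3) (Fin 3) K) * !![a / ϖ, 0, 0; 0, 1, 0; b, 0, ϖ])) ∧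
      ¬ (latt (((κ : GL (Fin 3) K) : Matrix (Fin 3) (Fin 3) K) * !![a / ϖ, 0, 0; 0, 1, 0; b, 0, ϖ])).map
          ((Matrix.toLin' (((γ : GL (Fin 3) K) : Matrix (Fin 3) (Fin 3) K) - 1)).restrictScalars 𝒪[K]) ≤
        scaleLattice (ϖ ^ d) (latt (((κ : GL (Fin 3) K) : Matrix (Fin 3) (Fin 3) K) * !![a / ϖ, 0, 0; 0, 1, 0; b, 0, ϖ])) ∧
      ¬ (latt (((κ : GL (Fin 3) K) : Matrix (Fin 3) (Fin 3) K) * !![a / ϖ, 0, 0; 0, 1, 0; b, 0, ϖ])).map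
          ((Matrix.toLin' ((((γ : GL (Fin 3) K) : Matrix (Fin 3) (Fin 3) K) - 1) ^ 2)).restrictScalars 𝒪[K]) ≤
        scaleLattice (ϖ ^ (2 * d - 1)) (latt (((κ : GL (Fin 3) K) : Matrix (Fin 3) (Fin 3) K) * !![a / ϖ, 0, 0; 0, 1, 0; b, 0, ϖ])) := by
  refine ⟨(map_sub_one_childLatt_le_scaleLattice_pred_iff hϖ (κ : GL (Fin 3) K) (γ : GL (Fin 3) K) ha hb hd hM).2 h20, ?_⟩
  exact not_lev_and_not_lev₂_childLatt_of_cube_le hvσ hϖ κ γ ha hb hd hlev hnil h20 hcol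

/-! ## §2 A NON-NULL line: the grandchild is `(d−2, rank ≤ 1)` -/

/-- **NON-NULL LINE ⇒ `(d−2, rank ≤ 1)`.**  If the corner is a unit at order `d` (`¬ |M′₂₀| ≤ |ϖ|^{d+1}`; `d ≥ 2`), then `(γ−1)·Λ′ ⊆ ϖ^{d−2}Λ′`, `¬ (γ−1)·Λ′ ⊆ ϖ^{d−1}Λ′` and
`(γ−1)²·Λ′ ⊆ ϖ^{2d−3}Λ′` (★ FILE H `…_pred_pred`, `…_pred_iff`, `map_sub_one_sq_childLatt_le_scaleLattice_of_le`). [cite: Kottwitz1986, §3] [cite: Tits1979, §3.5] -/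
theorem childLabels_of_not_null (hϖ : Valued.v ϖ = WithZero.exp (-1 : ℤ))
    (κ γ : unitaryGroupOfForm σ ((StdForm.antidiagonal 3).over K)) {a b : K} (ha : Valued.v a = 1) (hb : Valued.v b ≤ 1) {d : ℕ} (hd : 2 ≤ d)
    (hM : ∀ i j, Valued.v (((((κ : GL (Fin 3) K)⁻¹ : GL (Fin 3) K) : Matrix (Fin 3) (Fin 3) K) * (((γ : GL (Fin 3) K) : Matrix (Fin 3) (Fin 3) K) - 1) *
      ((κ : GL (Fin 3) K) : Matrix (Fin 3) (Fin 3) K)) i j) ≤ Valued.v ϖ ^ d)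
    (h20 : ¬ Valued.v (((((κ : GL (Fin 3) K)⁻¹ : GL (Fin 3) K) : Matrix (Fin 3) (Fin 3) K) * (((γ : GL (Fin 3) K) : Matrix (Fin 3) (Fin 3) K) - 1) *
      ((κ : GL (Fin 3) K) : Matrix (Fin 3) (Fin 3) K)) 2 0) ≤ Valued.v ϖ ^ (d + 1)) :
    (latt (((κ : GL (Fin 3) K) : Matrix (Fin 3) (Fin 3) K) * !![a / ϖ, 0, 0; 0, 1, 0; b, 0, ϖ])).map
          ((Matrix.toLin' (((γ : GL (Fin 3) K) : Matrix (Fin 3) (Fin 3) K) - 1)).restrictScalars 𝒪[K]) ≤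
        scaleLattice (ϖ ^ (d - 2)) (latt (((κ : GL (Fin 3) K) : Matrix (Fin 3) (Fin 3) K) * !![a / ϖ, 0, 0; 0, 1, 0; b, 0, ϖ])) ∧
      ¬ (latt (((κ : GL (Fin 3) K) : Matrix (Fin 3) (Fin 3) K) * !![a / ϖ, 0, 0; 0, 1, 0; b, 0, ϖ])).map
          ((Matrix.toLin' (((γ : GL (Fin 3) K) : Matrix (Fin 3) (Fin 3) K) - 1)).restrictScalars 𝒪[K]) ≤
        scaleLattice (ϖ ^ (d - 1)) (latt (((κ : GL (Fin 3) K) : Matrix (Fin 3) (Fin 3) K) * !![a / ϖ, 0, 0; 0, 1, 0; b, 0, ϖ])) ∧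
      (latt (((κ : GL (Fin 3) K) : Matrix (Fin 3) (Fin 3) K) * !![a / ϖ, 0, 0; 0, 1, 0; b, 0, ϖ])).map
          ((Matrix.toLin' ((((γ : GL (Fin 3) K) : Matrix (Fin 3) (Fin 3) K) - 1) ^ 2)).restrictScalars 𝒪[K]) ≤
        scaleLattice (ϖ ^ (2 * d - 3)) (latt (((κ : GL (Fin 3) K) : Matrix (Fin 3) (Fin 3) K) * !![a / ϖ, 0, 0; 0, 1, 0; b, 0, ϖ])) := by
  refine ⟨map_sub_one_childLatt_le_scaleLattice_pred_pred hϖ (κ : GL (Fin 3) K) (γ : GL (Fin 3) K) ha hb hd hM, ?_,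
    map_sub_one_sq_childLatt_le_scaleLattice_of_le hϖ (κ : GL (Fin 3) K) (γ : GL (Fin 3) K) ha hb hd hM⟩
  rw [map_sub_one_childLatt_le_scaleLattice_pred_iff hϖ (κ : GL (Fin 3) K) (γ : GL (Fin 3) K) ha hb (by omega) hM]
  exact h20

/-! ## §3 The class of a grandchild is EXACTLY the opposite of the class of its line -/

/-- **`CLS[Λ′] (d−2) c ↔` THE LINE HAS CLASS `−c`** (`c` a unit, `d ≥ 2`): the grandchild `Λ′ = latt(κ′·g(a,b))` carries the depth-`(d−2)` class `c` at SOME of its vectors iff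
the corner `M′₂₀ = B₀(κ′e₀, (γ−1)κ′e₀)` has class `−c` at order `d`.  «⇐»: ★ FILE H `exists_mem_childLatt_class_neg_of_lineClass` (witness `κ′·w(a,b)`).  «⇒» (EXCLUSION):
every `y ∈ Λ′` is `κ′u` with `u` in the dual box, where ★ FILE F `v_B₀_mulVec_add_sq_mul_lt` reads `B₀(y, (γ−1)y) ≡ −u₀²·M′₂₀ (mod ϖ^{d−2}·𝔪)`; a unit class `c·a²` at `y`
forces `ϖu₀` to be a unit and `(ϖ^d)⁻¹M′₂₀ ≡ −c·(a∕(ϖu₀))²`. [cite: Kottwitz1986, §3] [cite: BruhatTits1972, §10] [cite: Tits1979, §3.5] -/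
theorem childClass_iff_lineClass_neg (hvσ : ∀ z, Valued.v (σ z) = Valued.v z) (hσϖ : σ ϖ = -ϖ) (hϖ : Valued.v ϖ = WithZero.exp (-1 : ℤ))
    (hres : ∀ x : K, Valued.v x ≤ 1 → Valued.v (σ x - x) < 1)
    (κ γ : unitaryGroupOfForm σ ((StdForm.antidiagonal 3).over K)) {a b : K} (ha : Valued.v a = 1) (hb : Valued.v b ≤ 1) {d : ℕ} (hd : 2 ≤ d)
    (hM : ∀ i j, Valued.v (((((κ : GL (Fin 3) K)⁻¹ : GL (Fin 3) K) : Matrix (Fin 3) (Fin 3) K) * (((γ : GL (Fin 3) K) : Matrix (Fin 3) (Fin 3) K) - 1) *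
      ((κ : GL (Fin 3) K) : Matrix (Fin 3) (Fin 3) K)) i j) ≤ Valued.v ϖ ^ d)
    {c : K} (hc : Valued.v c = 1) :
    (∃ y ∈ latt (((κ : GL (Fin 3) K) : Matrix (Fin 3) (Fin 3) K) * !![a / ϖ, 0, 0; 0, 1, 0; b, 0, ϖ]), ∃ a' : K, Valued.v a' = 1 ∧
        Valued.v ((ϖ ^ (d - 2))⁻¹ * pairing σ ((StdForm.antidiagonal 3).over K) y ((((γ : GL (Fin 3) K) : Matrix (Fin 3) (Fin 3) K) - 1) *ᵥ y) - c * a' ^ 2) < 1) ↔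
      ∃ a₀ : K, Valued.v a₀ = 1 ∧ Valued.v ((ϖ ^ d)⁻¹ * ((((κ : GL (Fin 3) K)⁻¹ : GL (Fin 3) K) : Matrix (Fin 3) (Fin 3) K) *
        (((γ : GL (Fin 3) K) : Matrix (Fin 3) (Fin 3) K) - 1) * ((κ : GL (Fin 3) K) : Matrix (Fin 3) (Fin 3) K)) 2 0 - (-c) * a₀ ^ 2) < 1 := by
  have hϖ0 : ϖ ≠ 0 := fun h0 => by rw [h0, map_zero] at hϖ; exact WithZero.coe_ne_zero hϖ.symm
  have hvϖ0 : Valued.v ϖ ≠ 0 := (Valuation.ne_zero_iff _).2 hϖ0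
  have hϖ1 : Valued.v ϖ ≤ 1 := by rw [hϖ, ← WithZero.exp_zero]; exact WithZero.exp_le_exp.2 (by norm_num)
  set M : Matrix (Fin 3) (Fin 3) K := (((κ : GL (Fin 3) K)⁻¹ : GL (Fin 3) K) : Matrix (Fin 3) (Fin 3) K) * (((γ : GL (Fin 3) K) : Matrix (Fin 3) (Fin 3) K) - 1) *
      ((κ : GL (Fin 3) K) : Matrix (Fin 3) (Fin 3) K) with hMdef
  refine ⟨?_, fun hs => ?_⟩
  · rintro ⟨y, hy, a', ha', hcls⟩
    -- coordinates of `y` in the frame: `y = κ·u`, `u = g(a,b)·z`, `z ∈ 𝒪³`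
    obtain ⟨z, hz, rfl⟩ := Submodule.mem_map.1 hy
    have hzi : ∀ i, Valued.v (z i) ≤ 1 := hz
    set u : Fin 3 → K := (!![a / ϖ, 0, 0; 0, 1, 0; b, 0, ϖ] : Matrix (Fin 3) (Fin 3) K) *ᵥ z with hudef
    have hu : u = ![a / ϖ * z 0, z 1, b * z 0 + ϖ * z 2] := by
      rw [hudef]; ext i; fin_cases i <;> simp [Matrix.mulVec, dotProduct, Fin.sum_univ_three]
    have hy' : ((Matrix.toLin' (((κ : GL (Fin 3) K) : Matrix (Fin 3) (Fin 3) K) * !![a / ϖ, 0, 0; 0, 1, 0; b, 0, ϖ])).restrictScalars 𝒪[K]) z =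
        ((κ : GL (Fin 3) K) : Matrix (Fin 3) (Fin 3) K) *ᵥ u := by
      rw [LinearMap.restrictScalars_apply, Matrix.toLin'_apply, ← Matrix.mulVec_mulVec]
    have hu0 : Valued.v (ϖ * u 0) ≤ 1 := by
      rw [hu]; simp only [Matrix.cons_val_zero]
      rw [show ϖ * (a / ϖ * z 0) = a * z 0 by field_simp, map_mul, ha, one_mul]; exact hzi 0
    have hu1 : Valued.v (u 1) ≤ 1 := by rw [hu]; simpa using hzi 1
    have hu2 : Valued.v (u 2) ≤ 1 := by
      rw [hu]; simp only [Matrix.cons_val_two, Matrix.tail_cons, Matrix.head_cons]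
      refine (Valuation.map_add _ _ _).trans (max_le ?_ ?_)
      · rw [map_mul]; exact mul_le_one' hb (hzi 0)
      · rw [map_mul]; exact mul_le_one' hϖ1 (hzi 2)
    -- ★ F: `|B₀(u, Mu) + u₀²·M₂₀| < |ϖ|^(d-2)`, and `pairing(y, (γ−1)y) = B₀(u, Mu)`
    have hF := v_B₀_mulVec_add_sq_mul_lt hvσ hσϖ hϖ hres hd hM hu0 hu1 hu2
    have hκu := (mem_unitaryGroupOfForm_antidiagonal_iff (κ : GL (Fin 3) K)).1 κ.2
    rw [hy', pairing_antidiagonal, mulVec_coe_inv_mul_mul, hκu] at hcls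
    -- combine: `|c·a'² + (ϖu₀)²·(ϖ^d)⁻¹M₂₀| < 1`
    have hpow : (ϖ : K) ^ d = ϖ ^ (d - 2) * ϖ ^ 2 := by rw [← pow_add]; congr 1; omega
    have hne : (Valued.v ϖ ^ (d - 2))⁻¹ ≠ 0 := inv_ne_zero (pow_ne_zero _ hvϖ0)
    have hscaled : Valued.v ((ϖ ^ (d - 2))⁻¹ * (B₀ σ 3 u (M *ᵥ u) + u 0 ^ 2 * M 2 0)) < 1 := by
      rw [map_mul, map_inv₀, map_pow]
      calc (Valued.v ϖ ^ (d - 2))⁻¹ * Valued.v (B₀ σ 3 u (M *ᵥ u) + u 0 ^ 2 * M 2 0)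
          < (Valued.v ϖ ^ (d - 2))⁻¹ * Valued.v ϖ ^ (d - 2) := mul_lt_mul_of_pos_left hF (zero_lt_iff.2 hne)
        _ = 1 := inv_mul_cancel₀ (pow_ne_zero _ hvϖ0)
    have hkey : Valued.v (c * a' ^ 2 + (ϖ * u 0) ^ 2 * ((ϖ ^ d)⁻¹ * M 2 0)) < 1 := by
      have e : c * a' ^ 2 + (ϖ * u 0) ^ 2 * ((ϖ ^ d)⁻¹ * M 2 0) =
          (ϖ ^ (d - 2))⁻¹ * (B₀ σ 3 u (M *ᵥ u) + u 0 ^ 2 * M 2 0) - ((ϖ ^ (d - 2))⁻¹ * B₀ σ 3 u (M *ᵥ u) - c * a' ^ 2) := by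
        rw [hpow]; field_simp; ring
      rw [e]
      exact Valuation.map_sub_lt _ hscaled hcls
    -- `ϖu₀` is a unit (else `|c·a'²| < 1`)
    have hs₀ : Valued.v (ϖ * u 0) = 1 := by
      refine le_antisymm hu0 (not_lt.1 fun hlt => ?_)
      have ht : Valued.v ((ϖ ^ d)⁻¹ * M 2 0) ≤ 1 := by
        rw [map_mul, map_inv₀, map_pow]
        have h' := mul_le_mul' (le_refl ((Valued.v ϖ ^ d)⁻¹)) (hM 2 0)
        rwa [inv_mul_cancel₀ (pow_ne_zero _ hvϖ0)] at h'
      have hsmall : Valued.v ((ϖ * u 0) ^ 2 * ((ϖ ^ d)⁻¹ * M 2 0)) < 1 := by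
        rw [map_mul, map_pow]
        calc Valued.v (ϖ * u 0) ^ 2 * Valued.v ((ϖ ^ d)⁻¹ * M 2 0) ≤ Valued.v (ϖ * u 0) ^ 2 * 1 := mul_le_mul' le_rfl ht
          _ < 1 := by rw [mul_one]; exact pow_lt_one₀ zero_le hlt two_ne_zero
      have hca : Valued.v (c * a' ^ 2) < 1 := by
        have := Valuation.map_sub_lt _ hkey hsmall
        rwa [add_sub_cancel_right] at this
      rw [map_mul, map_pow, hc, ha', one_pow, one_mul] at hca
      exact lt_irrefl _ hca
    have hs₀0 : ϖ * u 0 ≠ 0 := fun h0 => by rw [h0, map_zero] at hs₀; exact zero_ne_one hs₀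
    have hu00 : u 0 ≠ 0 := fun h0 => hs₀0 (by rw [h0, mul_zero])
    refine ⟨a' / (ϖ * u 0), by rw [map_div₀, ha', hs₀, div_one], ?_⟩
    have e : (ϖ ^ d)⁻¹ * M 2 0 - (-c) * (a' / (ϖ * u 0)) ^ 2 = (c * a' ^ 2 + (ϖ * u 0) ^ 2 * ((ϖ ^ d)⁻¹ * M 2 0)) / (ϖ * u 0) ^ 2 := by
      field_simp
      ring
    rw [e, map_div₀, map_pow, hs₀, one_pow, div_one]
    exact hkey
  · have h := exists_mem_childLatt_class_neg_of_lineClass hvσ hσϖ hϖ hres κ γ ha hb hd hM hs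
    simpa only [neg_neg] using h

end Literature.NumberTheory.Automorphic.UnitaryLatticeTree

end
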